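import Mathlib.Analysis.Convex.Basic
import Mathlib.Analysis.Calculus.MeanValue
import Mathlib.Topology.MetricSpace.HausdorffDistance
import Literature.NumberTheory.LFunctions.SecondDifferenceTest
import Literature.Analysis.Fourier.StationaryPhaseLog
import HarnessLib

/-!
# The transverse sum of the two-dimensional van der Corput method: stationary points along parallel
# lattice lines, their constrained critical values, and the sum over the lines

Topic `Literature/NumberTheory/LFunctions`.  Everything here is PROVED; the definitions (`VdC.TransverseHyp` and
the proof-local `pt`, `chord`, `critX`, `critVal`, `ampl`) package the data.

Setting (abstract, phase-independent).  `T ⊂ ℂ` is a compact convex set, `d, e ∈ ℂ` span the lattice lines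
`ℓ_b = {a d + b e : a ∈ ℝ}` (`b ∈ ℤ`), `F : ℂ → ℝ` is a phase with directional derivatives `F_d, F_e, F_dd, F_de,
F_ee` on `T` (two derivatives along every line, `r ≤ F_dd ≤ Ar`, second-order Taylor control with constant `Λ₃`
for the short steps `s d ± e`, `|s| ≤ Λ₂/r + 2`, `|F_de| ≤ Λ₂`, `F_dd` Lipschitz), whose Hessian is NON-DEGENERATE in the quantitative form
`κ₁ ≤ (F_de² - F_dd F_ee)/F_dd ≤ κ₂` (`κ₁ > 0`; for harmonic `F = Im G` this is `|G''|²|Im(d ē)|²/F_dd`), and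
`φ : ℂ → ℝ` is a bounded Lipschitz weight vanishing within distance `δ₀` of the complement of `T`.

After the weighted `B`-process along each line `ℓ_b` (file `WeightedBProcess.lean`) the main terms are
`𝔣 ∑_ν A(b, ν) e(q(b, ν))`, where `x_ν(b)` is the stationary point of `a ↦ F(ad + be) - νa` on the chord
`ℓ_b ∩ T`, `q(b, ν)` the critical (= minimal) value and `A(b, ν) = φ(z_{b,ν}) (2π F_dd(z_{b,ν}))^{-1/2}`.  This file
constructs these objects (`critX`, `critVal`, `ampl`) and proves

* `TransverseHyp.critVal_step` — **the critical values along consecutive lines**: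
  `|q(b ± 1, ν) - q(b, ν) ∓ F_e(z) - ½ κ(z)| ≤ E_T`, `κ = F_ee - F_de²/F_dd`, for a stationary point `z = z_{b,ν}` at
  distance `≥ δ₁` from `Tᶜ` (upper bound: test the shifted point `x + s*`, `s* = ∓F_de/F_dd`, on the next line; lower
  bound: strong convexity along the next line around the same point) — hence two-sided bounds for the SECOND
  DIFFERENCES of `b ↦ q(b, ν)`, with no implicit-function theorem;
* `TransverseHyp.critX_step` — root localisation `|x_ν(b+1) - (x_ν(b) + s*)| ≤ 1/2`, whence
  `|A(b+1, ν) - A(b, ν)| ≤ δ_A` and the vanishing of `A` at the first line of every run of "deep" lines;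
* `TransverseHyp.norm_transverse_sum_le` — **the transverse bound**
  `‖∑_{b} ∑_{ν ∈ N} A(b,ν) e(q(b,ν))‖ ≤ #N · δ_A · L (12((2κ₂/κ₁ + 1) L (κ₁/2)^{1/2} + (κ₁/2)^{-1/2}) + 1)`,
  `L = b₂ - b₁ + 1`, by the gapped Abel/second-difference lemma `VdC.norm_sum_gapped_le'`.

## References

* E. C. Titchmarsh, *On Epstein's zeta-function*, Proc. London Math. Soc. (2) 36 (1934), 485–500, and *The
  lattice-points in a circle*, ibid. 38 (1935), 96–115 (the two-dimensional method, iterated one-dimensional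
  processes). [Titchmarsh1935Lattice]
* E. Krätzel, *Lattice Points*, Kluwer 1988, §2.2 (double exponential sums). [Kratzel1988]
* S. W. Graham, G. Kolesnik, *Van der Corput's Method of Exponential Sums*, LMS LN 126 (1991), §§2–3 and Lemma 6.10.
  [GrahamKolesnik1991]
-/

noncomputable section

open Finset Real Set Metric Classical

namespace Literature.NumberTheory.LFunctions
namespace VdC

open Literature.Analysis.Fourier

/-! ### One-dimensional convex analysis along a line -/

section ConvexLine

variable {Ψ Ψ' : ℝ → ℝ} {α β r : ℝ}

/-- If `k(a₀) = 0` and `k' ≤ 0` on `(a, a₀)` then `k(a) ≥ 0` (one mean value, to the left). [folklore] -/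
theorem nonneg_of_deriv_nonpos_left {k k' : ℝ → ℝ} {a₀ a : ℝ} (h : a ≤ a₀)
    (hk : ∀ y ∈ Icc a a₀, HasDerivAt k (k' y) y) (hk' : ∀ y ∈ Ioo a a₀, k' y ≤ 0) (h0 : k a₀ = 0) :
    0 ≤ k a := by
  rcases eq_or_lt_of_le h with h' | h'
  · subst h'; rw [h0]
  obtain ⟨ξ, hξ, hξ'⟩ := exists_hasDerivAt_eq_slope k k' h'
    (fun y hy => (hk y hy).continuousAt.continuousWithinAt) (fun y hy => hk y (Ioo_subset_Icc_self hy))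
  have : k a₀ - k a = k' ξ * (a₀ - a) := by rw [hξ']; field_simp
  rw [h0, zero_sub] at this
  have : k a = -(k' ξ * (a₀ - a)) := by linarith
  rw [this]; exact neg_nonneg.2 (mul_nonpos_of_nonpos_of_nonneg (hk' ξ hξ) (by linarith))

/-- Strong convexity from the derivative increments: if `Ψ'(y) - Ψ'(x) ≥ r(y - x)` for `x ≤ y` in `[α, β]`,
then `Ψ(a) ≥ Ψ(a₀) + Ψ'(a₀)(a - a₀) + (r/2)(a - a₀)²` for `a, a₀ ∈ [α, β]`. [folklore] -/
theorem quad_lower (hΨ : ∀ y ∈ Icc α β, HasDerivAt Ψ (Ψ' y) y)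
    (hincr : ∀ x ∈ Icc α β, ∀ y ∈ Icc α β, x ≤ y → r * (y - x) ≤ Ψ' y - Ψ' x)
    {a₀ a : ℝ} (ha₀ : a₀ ∈ Icc α β) (ha : a ∈ Icc α β) :
    Ψ a₀ + Ψ' a₀ * (a - a₀) + r / 2 * (a - a₀) ^ 2 ≤ Ψ a := by
  set k : ℝ → ℝ := fun t => Ψ t - Ψ a₀ - Ψ' a₀ * (t - a₀) - r / 2 * (t - a₀) ^ 2 with hk
  have hkd : ∀ t ∈ Icc α β, HasDerivAt k (Ψ' t - Ψ' a₀ - r * (t - a₀)) t := by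
    intro t ht
    have h1 : HasDerivAt (fun t => Ψ' a₀ * (t - a₀)) (Ψ' a₀) t := by
      simpa using ((hasDerivAt_id t).sub_const a₀).const_mul (Ψ' a₀)
    have h2 : HasDerivAt (fun t => r / 2 * (t - a₀) ^ 2) (r * (t - a₀)) t := by
      have := (((hasDerivAt_id t).sub_const a₀).fun_pow 2).const_mul (r / 2)
      exact this.congr_deriv (by simp; ring)
    exact ((((hΨ t ht).sub_const (Ψ a₀)).sub h1).sub h2).congr_deriv (by ring)
  have hk0 : k a₀ = 0 := by simp [hk]
  suffices 0 ≤ k a by simp only [hk] at this; linarith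
  rcases le_total a₀ a with h | h
  · refine apply_nonneg_of_deriv_nonneg h (fun t ht => hkd t ⟨ha₀.1.trans ht.1, ht.2.trans ha.2⟩) ?_ hk0
    intro t ht
    have := hincr a₀ ha₀ t ⟨ha₀.1.trans ht.1.le, ht.2.le.trans ha.2⟩ ht.1.le
    linarith
  · refine nonneg_of_deriv_nonpos_left h (fun t ht => hkd t ⟨ha.1.trans ht.1, ht.2.trans ha₀.2⟩) ?_ hk0
    intro t ht
    have := hincr t ⟨ha.1.trans ht.1.le, ht.2.le.trans ha₀.2⟩ a₀ ha₀ ht.2.le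
    linarith

/-- The minimum of a strongly convex function is at least `Ψ(a₀) - Ψ'(a₀)²/(2r)` (`r > 0`). [folklore] -/
theorem min_lower (hr : 0 < r) (hΨ : ∀ y ∈ Icc α β, HasDerivAt Ψ (Ψ' y) y)
    (hincr : ∀ x ∈ Icc α β, ∀ y ∈ Icc α β, x ≤ y → r * (y - x) ≤ Ψ' y - Ψ' x)
    {a₀ a : ℝ} (ha₀ : a₀ ∈ Icc α β) (ha : a ∈ Icc α β) :
    Ψ a₀ - Ψ' a₀ ^ 2 / (2 * r) ≤ Ψ a := by
  have h := quad_lower hΨ hincr ha₀ ha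
  have hsq : 0 ≤ r / 2 * ((a - a₀) + Ψ' a₀ / r) ^ 2 := by positivity
  have : Ψ' a₀ * (a - a₀) + r / 2 * (a - a₀) ^ 2 = r / 2 * ((a - a₀) + Ψ' a₀ / r) ^ 2 - Ψ' a₀ ^ 2 / (2 * r) := by
    field_simp; ring
  linarith

/-- A critical point of a strongly convex function is its strict minimiser: `Ψ(a) ≥ Ψ(x) + (r/2)(a - x)²`.
[folklore] -/
theorem crit_min (hΨ : ∀ y ∈ Icc α β, HasDerivAt Ψ (Ψ' y) y)
    (hincr : ∀ x ∈ Icc α β, ∀ y ∈ Icc α β, x ≤ y → r * (y - x) ≤ Ψ' y - Ψ' x)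
    {x a : ℝ} (hx : x ∈ Icc α β) (hcrit : Ψ' x = 0) (ha : a ∈ Icc α β) :
    Ψ x + r / 2 * (a - x) ^ 2 ≤ Ψ a := by
  have := quad_lower hΨ hincr hx ha
  rw [hcrit, zero_mul, add_zero] at this
  exact this

/-- The derivative of a strongly convex function separates points: `|Ψ'(u) - Ψ'(v)| ≥ r|u - v|`. [folklore] -/
theorem deriv_sep (hincr : ∀ x ∈ Icc α β, ∀ y ∈ Icc α β, x ≤ y → r * (y - x) ≤ Ψ' y - Ψ' x)
    {u v : ℝ} (hu : u ∈ Icc α β) (hv : v ∈ Icc α β) : r * |u - v| ≤ |Ψ' u - Ψ' v| := by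
  rcases le_total u v with h | h
  · have := hincr u hu v hv h
    calc r * |u - v| = r * (v - u) := by rw [abs_of_nonpos (by linarith)]; ring
      _ ≤ Ψ' v - Ψ' u := this
      _ ≤ |Ψ' u - Ψ' v| := by rw [abs_sub_comm]; exact le_abs_self _
  · have := hincr v hv u hu h
    calc r * |u - v| = r * (u - v) := by rw [abs_of_nonneg (by linarith)]
      _ ≤ Ψ' u - Ψ' v := this
      _ ≤ |Ψ' u - Ψ' v| := le_abs_self _

end ConvexLine

/-! ### The hypotheses -/

/-- Hypotheses of the transverse step: a compact convex `T ⊂ ℂ`, lattice-line directions `d ≠ 0`, `e`, a phase `F`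
with directional-derivative data `F_d, F_e, F_dd, F_de, F_ee` on `T` (two derivatives along each line, `r ≤ F_dd ≤ Ar`,
`|F_de| ≤ Λ₂`, the non-degeneracy `κ₁ ≤ (F_de² - F_dd F_ee)/F_dd ≤ κ₂`, `F_dd` `L₂`-Lipschitz, Taylor control `Λ₃`
for the steps `s d + σ e`, `|σ| ≤ 1`), a weight `φ` (`|φ| ≤ G`, `Lφ`-Lipschitz, vanishing within `δ₀` of `Tᶜ`),
and the smallness conditions making the root localisation and the second differences work. [folklore] -/
structure TransverseHyp (T : Set ℂ) (d e : ℂ) (F Fd Fe Fdd Fde Fee : ℂ → ℝ) (φ : ℂ → ℝ)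
    (r A Λ₂ Λ₃ κ₁ κ₂ L₂ G Lφ δ₀ : ℝ) : Prop where
  convex : Convex ℝ T
  compact : IsCompact T
  nonuniv : Tᶜ.Nonempty
  d_ne : d ≠ 0
  hr : 0 < r
  hA : 1 ≤ A
  hΛ₂ : 0 ≤ Λ₂
  hΛ₃ : 0 ≤ Λ₃
  hκ₁ : 0 < κ₁
  hκ₁₂ : κ₁ ≤ κ₂
  hL₂ : 0 ≤ L₂
  hG : 0 ≤ G
  hLφ : 0 ≤ Lφ
  line1 : ∀ (c : ℝ) (a : ℝ), (a : ℂ) * d + (c : ℂ) * e ∈ T →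
    HasDerivAt (fun a : ℝ => F ((a : ℂ) * d + (c : ℂ) * e)) (Fd ((a : ℂ) * d + (c : ℂ) * e)) a
  line2 : ∀ (c : ℝ) (a : ℝ), (a : ℂ) * d + (c : ℂ) * e ∈ T →
    HasDerivAt (fun a : ℝ => Fd ((a : ℂ) * d + (c : ℂ) * e)) (Fdd ((a : ℂ) * d + (c : ℂ) * e)) a
  hFdd : ∀ z ∈ T, r ≤ Fdd z ∧ Fdd z ≤ A * r
  hFde : ∀ z ∈ T, |Fde z| ≤ Λ₂
  hκ : ∀ z ∈ T, κ₁ ≤ (Fde z ^ 2 - Fdd z * Fee z) / Fdd z ∧ (Fde z ^ 2 - Fdd z * Fee z) / Fdd z ≤ κ₂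
  lipFdd : ∀ z ∈ T, ∀ z' ∈ T, |Fdd z - Fdd z'| ≤ L₂ * ‖z - z'‖
  taylorF : ∀ z ∈ T, ∀ (s σ : ℝ), |s| ≤ Λ₂ / r + 2 → |σ| ≤ 1 → z + ((s : ℂ) * d + (σ : ℂ) * e) ∈ T →
    |F (z + ((s : ℂ) * d + (σ : ℂ) * e)) - F z - (s * Fd z + σ * Fe z)
      - (s ^ 2 * Fdd z + 2 * s * σ * Fde z + σ ^ 2 * Fee z) / 2| ≤ Λ₃ * (|s| + 1) ^ 3
  taylorFd : ∀ z ∈ T, ∀ (s σ : ℝ), |s| ≤ Λ₂ / r + 2 → |σ| ≤ 1 → z + ((s : ℂ) * d + (σ : ℂ) * e) ∈ T →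
    |Fd (z + ((s : ℂ) * d + (σ : ℂ) * e)) - Fd z - (s * Fdd z + σ * Fde z)| ≤ Λ₃ * (|s| + 1) ^ 2
  hφG : ∀ z ∈ T, |φ z| ≤ G
  lipφ : ∀ z ∈ T, ∀ z' ∈ T, |φ z - φ z'| ≤ Lφ * ‖z - z'‖
  hφ0 : ∀ z, infDist z Tᶜ < δ₀ → φ z = 0
  hδ₀ : 2 * (‖e‖ + (Λ₂ / r + 2) * ‖d‖ + 1) ≤ δ₀
  hsmall1 : Λ₃ * (Λ₂ / r + 1) ^ 2 ≤ r / 2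
  hsmall2 : 4 * (Λ₃ * (Λ₂ / r + 1) ^ 3 + Λ₃ ^ 2 * (Λ₂ / r + 1) ^ 4 / (2 * r)) ≤ κ₁

namespace TransverseHyp

variable {T : Set ℂ} {d e : ℂ} {F Fd Fe Fdd Fde Fee : ℂ → ℝ} {φ : ℂ → ℝ}
  {r A Λ₂ Λ₃ κ₁ κ₂ L₂ G Lφ δ₀ : ℝ}
  (H : TransverseHyp T d e F Fd Fe Fdd Fde Fee φ r A Λ₂ Λ₃ κ₁ κ₂ L₂ G Lφ δ₀)
include H

/-! ### Points, lines, chords -/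

/-- The point `a d + c e` of the line `ℓ_c`. [folklore] -/
def pt (_H : TransverseHyp T d e F Fd Fe Fdd Fde Fee φ r A Λ₂ Λ₃ κ₁ κ₂ L₂ G Lφ δ₀) (a c : ℝ) : ℂ :=
  (a : ℂ) * d + (c : ℂ) * e

/-- Unfolding `pt`. [folklore] -/
theorem pt_def (a c : ℝ) : H.pt a c = (a : ℂ) * d + (c : ℂ) * e := rfl

/-- `pt (a + s) (c + σ) = pt a c + (s d + σ e)`. [folklore] -/
theorem pt_add (a c s σ : ℝ) : H.pt (a + s) (c + σ) = H.pt a c + ((s : ℂ) * d + (σ : ℂ) * e) := by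
  simp only [pt_def]; push_cast; ring

/-- `‖pt a c - pt a' c‖ = |a - a'| ‖d‖`. [folklore] -/
theorem norm_pt_sub_pt (a a' c : ℝ) : ‖H.pt a c - H.pt a' c‖ = |a - a'| * ‖d‖ := by
  rw [pt_def, pt_def, show (a : ℂ) * d + (c : ℂ) * e - ((a' : ℂ) * d + (c : ℂ) * e) = ((a - a' : ℝ) : ℂ) * d by
    push_cast; ring, norm_mul, Complex.norm_real, Real.norm_eq_abs]

omit H in
/-- `‖s d + σ e‖ ≤ |s| ‖d‖ + |σ| ‖e‖`. [folklore] -/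
theorem norm_step_le (s σ : ℝ) : ‖(s : ℂ) * d + (σ : ℂ) * e‖ ≤ |s| * ‖d‖ + |σ| * ‖e‖ := by
  refine (norm_add_le _ _).trans (le_of_eq ?_)
  rw [norm_mul, norm_mul, Complex.norm_real, Complex.norm_real, Real.norm_eq_abs, Real.norm_eq_abs]

/-- The chord of the line `ℓ_c`: `{a : pt a c ∈ T}`. [folklore] -/
def chord (_H : TransverseHyp T d e F Fd Fe Fdd Fde Fee φ r A Λ₂ Λ₃ κ₁ κ₂ L₂ G Lφ δ₀) (c : ℝ) : Set ℝ :=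
  {a : ℝ | (a : ℂ) * d + (c : ℂ) * e ∈ T}

/-- Membership in a chord. [folklore] -/
theorem mem_chord {c a : ℝ} : a ∈ H.chord c ↔ H.pt a c ∈ T := Iff.rfl

/-- The parametrisation of a line is continuous. [folklore] -/
theorem continuous_pt (c : ℝ) : Continuous fun a : ℝ => H.pt a c := by
  unfold pt; fun_prop

/-- Chords are closed. [folklore] -/
theorem isClosed_chord (c : ℝ) : IsClosed (H.chord c) :=
  H.compact.isClosed.preimage (H.continuous_pt c)

/-- Chords are bounded (in fact compact). [folklore] -/
theorem isCompact_chord (c : ℝ) : IsCompact (H.chord c) := by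
  -- `T` is bounded, and `a ↦ pt a c` is a closed embedding up to the factor `‖d‖ > 0`
  obtain ⟨R, hR⟩ := H.compact.isBounded.subset_closedBall (0 : ℂ)
  have hd : 0 < ‖d‖ := norm_pos_iff.2 H.d_ne
  have hsub : H.chord c ⊆ Icc (-( (R + ‖(c : ℂ) * e‖) / ‖d‖)) ((R + ‖(c : ℂ) * e‖) / ‖d‖) := by
    intro a ha
    have hz := hR ha
    rw [mem_closedBall, dist_zero_right] at hz
    have h1 : ‖(a : ℂ) * d‖ ≤ R + ‖(c : ℂ) * e‖ := by
      have := norm_sub_le ((a : ℂ) * d + (c : ℂ) * e) ((c : ℂ) * e)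
      rw [add_sub_cancel_right] at this
      linarith
    rw [norm_mul, Complex.norm_real, Real.norm_eq_abs] at h1
    rw [Set.mem_Icc, ← abs_le, le_div_iff₀ hd]
    exact h1
  exact (isCompact_Icc.of_isClosed_subset (H.isClosed_chord c) hsub)

/-- Chords are order-connected (convexity of `T`). [folklore] -/
theorem ordConnected_chord (c : ℝ) : (H.chord c).OrdConnected := by
  refine ⟨fun a ha a' ha' x hx => ?_⟩
  rw [mem_chord] at ha ha' ⊢
  rcases eq_or_lt_of_le (hx.1.trans hx.2) with h | h
  · -- `a = a'`
    have : x = a := le_antisymm (h ▸ hx.2) hx.1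
    rw [this]; exact ha
  -- `pt x c` is a convex combination of `pt a c` and `pt a' c`
  set θ : ℝ := (a' - x) / (a' - a) with hθ
  have hden : 0 < a' - a := by linarith
  have hθ0 : 0 ≤ θ := div_nonneg (by linarith [hx.2]) hden.le
  have hθ1 : θ ≤ 1 := by rw [hθ, div_le_one hden]; linarith [hx.1]
  have hconv := H.convex ha ha' hθ0 (by linarith) (by ring : θ + (1 - θ) = 1)
  have heq : θ • H.pt a c + (1 - θ) • H.pt a' c = H.pt x c := by
    simp only [pt_def, Complex.real_smul]
    have hx' : (x : ℂ) = θ * a + (1 - θ) * a' := by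
      have : x = θ * a + (1 - θ) * a' := by rw [hθ]; field_simp; ring
      exact_mod_cast congrArg (fun y : ℝ => (y : ℂ)) this
    rw [hx']; push_cast; ring
  rw [heq] at hconv
  exact hconv

/-- A nonempty chord is the closed interval between its infimum and supremum. [folklore] -/
theorem chord_eq_Icc {c : ℝ} (hne : (H.chord c).Nonempty) :
    H.chord c = Icc (sInf (H.chord c)) (sSup (H.chord c)) := by
  have hbdd := (H.isCompact_chord c).isBounded
  have hb : BddBelow (H.chord c) := hbdd.bddBelow
  have ha : BddAbove (H.chord c) := hbdd.bddAbove
  have hmin : sInf (H.chord c) ∈ H.chord c := (H.isClosed_chord c).csInf_mem hne hb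
  have hmax : sSup (H.chord c) ∈ H.chord c := (H.isClosed_chord c).csSup_mem hne ha
  ext x
  constructor
  · intro hx; exact ⟨csInf_le hb hx, le_csSup ha hx⟩
  · intro hx; exact (H.ordConnected_chord c).out hmin hmax hx

/-- If a whole interval of parameters gives points of `T`, it lies in the chord interval. [folklore] -/
theorem Icc_subset_chord {c u v : ℝ} (h : ∀ a ∈ Icc u v, H.pt a c ∈ T) (huv : u ≤ v) :
    (H.chord c).Nonempty ∧ sInf (H.chord c) ≤ u ∧ v ≤ sSup (H.chord c) := by
  have hu : u ∈ H.chord c := h u (left_mem_Icc.2 huv)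
  have hv : v ∈ H.chord c := h v (right_mem_Icc.2 huv)
  have hbdd := (H.isCompact_chord c).isBounded
  exact ⟨⟨u, hu⟩, csInf_le hbdd.bddBelow hu, le_csSup hbdd.bddAbove hv⟩

omit H in
/-- Points near a deep point are in `T`: if `infDist z Tᶜ ≥ δ` and `‖z' - z‖ < δ` then `z' ∈ T`. [folklore] -/
theorem mem_of_norm_sub_lt {z z' : ℂ} {δ : ℝ} (hz : δ ≤ infDist z Tᶜ) (hzz' : ‖z' - z‖ < δ) : z' ∈ T := by
  by_contra h
  have : infDist z Tᶜ ≤ dist z z' := infDist_le_dist_of_mem (mem_compl h)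
  rw [dist_comm, dist_eq_norm] at this
  linarith


/-! ### Chord end-points and the derivative along a line -/

/-- The lower end-point of the chord of `ℓ_c` (junk if the chord is empty). [folklore] -/
def lo (_H : TransverseHyp T d e F Fd Fe Fdd Fde Fee φ r A Λ₂ Λ₃ κ₁ κ₂ L₂ G Lφ δ₀) (c : ℝ) : ℝ :=
  sInf {a : ℝ | (a : ℂ) * d + (c : ℂ) * e ∈ T}

/-- The upper end-point of the chord of `ℓ_c` (junk if the chord is empty). [folklore] -/
def hi (_H : TransverseHyp T d e F Fd Fe Fdd Fde Fee φ r A Λ₂ Λ₃ κ₁ κ₂ L₂ G Lφ δ₀) (c : ℝ) : ℝ :=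
  sSup {a : ℝ | (a : ℂ) * d + (c : ℂ) * e ∈ T}

/-- A nonempty chord is `[lo, hi]`. [folklore] -/
theorem chord_eq {c : ℝ} (hne : (H.chord c).Nonempty) : H.chord c = Icc (H.lo c) (H.hi c) :=
  H.chord_eq_Icc hne

/-- `lo ≤ hi` for a nonempty chord. [folklore] -/
theorem lo_le_hi {c : ℝ} (hne : (H.chord c).Nonempty) : H.lo c ≤ H.hi c := by
  obtain ⟨a, ha⟩ := hne
  rw [H.chord_eq ⟨a, ha⟩, Set.mem_Icc] at ha
  exact ha.1.trans ha.2

/-- `lo` belongs to the chord. [folklore] -/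
theorem lo_mem {c : ℝ} (hne : (H.chord c).Nonempty) : H.lo c ∈ H.chord c := by
  rw [H.chord_eq hne]; exact left_mem_Icc.2 (H.lo_le_hi hne)

/-- `hi` belongs to the chord. [folklore] -/
theorem hi_mem {c : ℝ} (hne : (H.chord c).Nonempty) : H.hi c ∈ H.chord c := by
  rw [H.chord_eq hne]; exact right_mem_Icc.2 (H.lo_le_hi hne)

/-- An interval of parameters inside `T` is inside `[lo, hi]`. [folklore] -/
theorem lo_le_of_Icc {c u v : ℝ} (h : ∀ a ∈ Icc u v, H.pt a c ∈ T) (huv : u ≤ v) :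
    (H.chord c).Nonempty ∧ H.lo c ≤ u ∧ v ≤ H.hi c :=
  H.Icc_subset_chord h huv

/-- Just below `lo` the line has left `T`: `infDist (pt lo c) Tᶜ = 0`, and likewise at `hi`. [folklore] -/
theorem infDist_endpoint_eq_zero (c : ℝ) :
    infDist (H.pt (H.lo c) c) Tᶜ = 0 ∧ infDist (H.pt (H.hi c) c) Tᶜ = 0 := by
  have hd : 0 < ‖d‖ := norm_pos_iff.2 H.d_ne
  have hbdd := (H.isCompact_chord c).isBounded
  have key : ∀ (x : ℝ) (s : ℝ), (∀ ε : ℝ, 0 < ε → H.pt (x + s * ε) c ∉ T) → |s| = 1 → infDist (H.pt x c) Tᶜ = 0 := by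
    intro x s hout hs
    refine le_antisymm (le_of_forall_pos_le_add fun ε hε => ?_) infDist_nonneg
    rw [zero_add]
    have hmem : H.pt (x + s * (ε / ‖d‖)) c ∈ Tᶜ := hout _ (div_pos hε hd)
    refine (infDist_le_dist_of_mem hmem).trans ?_
    rw [dist_comm, dist_eq_norm, show x + s * (ε / ‖d‖) = x + s * (ε / ‖d‖) from rfl, H.norm_pt_sub_pt]
    rw [show x + s * (ε / ‖d‖) - x = s * (ε / ‖d‖) by ring, abs_mul, hs, one_mul, abs_of_pos (div_pos hε hd),
      div_mul_cancel₀ _ hd.ne']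
  constructor
  · refine key (H.lo c) (-1) (fun ε hε hmem => ?_) (by norm_num)
    have : H.lo c + -1 * ε ∈ H.chord c := hmem
    have := csInf_le hbdd.bddBelow this
    change H.lo c ≤ H.lo c + -1 * ε at this
    linarith
  · refine key (H.hi c) 1 (fun ε hε hmem => ?_) (by norm_num)
    have : H.hi c + 1 * ε ∈ H.chord c := hmem
    have := le_csSup hbdd.bddAbove this
    change H.hi c + 1 * ε ≤ H.hi c at this
    linarith

/-- Increments of `a ↦ F_d(pt a c)` along a chord: `r(v - u) ≤ F_d(pt v c) - F_d(pt u c) ≤ Ar(v - u)`. [folklore] -/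
theorem Fd_incr {c u v : ℝ} (hu : u ∈ H.chord c) (hv : v ∈ H.chord c) (huv : u ≤ v) :
    r * (v - u) ≤ Fd (H.pt v c) - Fd (H.pt u c) ∧ Fd (H.pt v c) - Fd (H.pt u c) ≤ A * r * (v - u) := by
  rcases eq_or_lt_of_le huv with h | h
  · subst h; simp
  have hsub : ∀ y ∈ Icc u v, y ∈ H.chord c := fun y hy => (H.ordConnected_chord c).out hu hv hy
  obtain ⟨ξ, hξ, hξ'⟩ := exists_hasDerivAt_eq_slope (fun a : ℝ => Fd (H.pt a c)) (fun a => Fdd (H.pt a c)) h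
    (fun y hy => (H.line2 c y (hsub y hy)).continuousAt.continuousWithinAt)
    (fun y hy => H.line2 c y (hsub y (Ioo_subset_Icc_self hy)))
  have heq : Fd (H.pt v c) - Fd (H.pt u c) = Fdd (H.pt ξ c) * (v - u) := by
    have := hξ'; simp only [pt_def] at this ⊢; rw [this]; field_simp
  have hb := H.hFdd _ (hsub ξ (Ioo_subset_Icc_self hξ))
  rw [heq]
  exact ⟨mul_le_mul_of_nonneg_right hb.1 (by linarith), mul_le_mul_of_nonneg_right hb.2 (by linarith)⟩

/-- The phase `Ψ(a) = F(pt a c) - νa` along a chord and its derivative `F_d(pt a c) - ν`. [folklore] -/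
theorem hasDerivAt_Ψ (c ν : ℝ) {a : ℝ} (ha : a ∈ H.chord c) :
    HasDerivAt (fun a : ℝ => F (H.pt a c) - ν * a) (Fd (H.pt a c) - ν) a := by
  have h1 := H.line1 c a ha
  have h2 : HasDerivAt (fun y : ℝ => ν * y) ν a := by simpa using (hasDerivAt_id a).const_mul ν
  exact h1.sub h2

/-- The increment hypothesis of the convex-line lemmas for `Ψ' = F_d ∘ pt - ν` on `[lo, hi]`. [folklore] -/
theorem Ψ'_incr {c : ℝ} (hne : (H.chord c).Nonempty) (ν : ℝ) :
    ∀ x ∈ Icc (H.lo c) (H.hi c), ∀ y ∈ Icc (H.lo c) (H.hi c), x ≤ y →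
      r * (y - x) ≤ (Fd (H.pt y c) - ν) - (Fd (H.pt x c) - ν) := by
  intro x hx y hy hxy
  rw [← H.chord_eq hne] at hx hy
  have := (H.Fd_incr hx hy hxy).1
  linarith

/-- `Ψ` has its derivative on `[lo, hi]`. [folklore] -/
theorem hasDerivAt_Ψ' {c : ℝ} (hne : (H.chord c).Nonempty) (ν : ℝ) :
    ∀ y ∈ Icc (H.lo c) (H.hi c), HasDerivAt (fun a : ℝ => F (H.pt a c) - ν * a) (Fd (H.pt y c) - ν) y := by
  intro y hy
  rw [← H.chord_eq hne] at hy
  exact H.hasDerivAt_Ψ c ν hy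

/-! ### Stationary points, critical values, amplitudes -/

/-- "The line `ℓ_c` carries an interior stationary point for the frequency `ν`". [folklore] -/
def CritInt (_H : TransverseHyp T d e F Fd Fe Fdd Fde Fee φ r A Λ₂ Λ₃ κ₁ κ₂ L₂ G Lφ δ₀) (c ν : ℝ) : Prop :=
  ∃ x : ℝ, {a : ℝ | (a : ℂ) * d + (c : ℂ) * e ∈ T}.Nonempty ∧
    x ∈ Ioo (sInf {a : ℝ | (a : ℂ) * d + (c : ℂ) * e ∈ T}) (sSup {a : ℝ | (a : ℂ) * d + (c : ℂ) * e ∈ T}) ∧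
      Fd ((x : ℂ) * d + (c : ℂ) * e) = ν

/-- Unfolding `CritInt`. [folklore] -/
theorem critInt_iff (c ν : ℝ) :
    H.CritInt c ν ↔ ∃ x : ℝ, (H.chord c).Nonempty ∧ x ∈ Ioo (H.lo c) (H.hi c) ∧ Fd (H.pt x c) = ν := Iff.rfl

/-- The stationary point `x_ν(c)` (junk: `lo c`, when there is no interior stationary point). [folklore] -/
def critX (_H : TransverseHyp T d e F Fd Fe Fdd Fde Fee φ r A Λ₂ Λ₃ κ₁ κ₂ L₂ G Lφ δ₀) (c ν : ℝ) : ℝ :=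
  if h : _H.CritInt c ν then Classical.choose h else _H.lo c

/-- The stationary point as a point of the plane. [folklore] -/
def critZ (_H : TransverseHyp T d e F Fd Fe Fdd Fde Fee φ r A Λ₂ Λ₃ κ₁ κ₂ L₂ G Lφ δ₀) (c ν : ℝ) : ℂ :=
  _H.pt (_H.critX c ν) c

/-- The critical (= minimal) value `q(c, ν) = min_{a ∈ chord} (F(pt a c) - νa)` (junk when the chord is empty).
[folklore] -/
def critVal (_H : TransverseHyp T d e F Fd Fe Fdd Fde Fee φ r A Λ₂ Λ₃ κ₁ κ₂ L₂ G Lφ δ₀) (c ν : ℝ) : ℝ :=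
  sInf ((fun a : ℝ => F ((a : ℂ) * d + (c : ℂ) * e) - ν * a) '' {a : ℝ | (a : ℂ) * d + (c : ℂ) * e ∈ T})

/-- The amplitude `A(c, ν) = φ(z_{c,ν}) (2π F_dd(z_{c,ν}))^{-1/2}` (zero without interior stationary point).
[folklore] -/
def ampl (_H : TransverseHyp T d e F Fd Fe Fdd Fde Fee φ r A Λ₂ Λ₃ κ₁ κ₂ L₂ G Lφ δ₀) (c ν : ℝ) : ℝ :=
  if _H.CritInt c ν then φ (_H.critZ c ν) / Real.sqrt (2 * π * Fdd (_H.critZ c ν)) else 0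

/-- The defining property of `critX` when an interior stationary point exists. [folklore] -/
theorem critX_spec {c ν : ℝ} (h : H.CritInt c ν) :
    (H.chord c).Nonempty ∧ H.critX c ν ∈ Ioo (H.lo c) (H.hi c) ∧ Fd (H.critZ c ν) = ν := by
  have hs := Classical.choose_spec h
  have : H.critX c ν = Classical.choose h := by rw [critX, dif_pos h]
  rw [critZ, this]
  exact hs

/-- `critZ` unfolds to `pt critX`. [folklore] -/
theorem critZ_def (c ν : ℝ) : H.critZ c ν = H.pt (H.critX c ν) c := rfl

/-- The stationary point lies in the chord, hence in `T`. [folklore] -/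
theorem critX_mem {c ν : ℝ} (h : H.CritInt c ν) : H.critX c ν ∈ H.chord c ∧ H.critZ c ν ∈ T := by
  obtain ⟨hne, hx, _⟩ := H.critX_spec h
  have : H.critX c ν ∈ H.chord c := by rw [H.chord_eq hne]; exact Ioo_subset_Icc_self hx
  exact ⟨this, this⟩

/-- Uniqueness of stationary points on a chord. [folklore] -/
theorem crit_unique {c ν x x' : ℝ} (hx : x ∈ H.chord c) (hx' : x' ∈ H.chord c)
    (h1 : Fd (H.pt x c) = ν) (h2 : Fd (H.pt x' c) = ν) : x = x' := by
  have hne : (H.chord c).Nonempty := ⟨x, hx⟩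
  rw [H.chord_eq hne] at hx hx'
  have := deriv_sep (H.Ψ'_incr hne ν) hx hx'
  rw [h1, h2] at this
  norm_num at this
  have hr := H.hr
  have : |x - x'| ≤ 0 := by nlinarith [abs_nonneg (x - x')]
  exact sub_eq_zero.1 (abs_nonpos_iff.1 this)

/-- An interior stationary point IS `critX`. [folklore] -/
theorem critX_eq_of_mem_Ioo {c ν x : ℝ} (hne : (H.chord c).Nonempty) (hx : x ∈ Ioo (H.lo c) (H.hi c))
    (hcrit : Fd (H.pt x c) = ν) : H.CritInt c ν ∧ H.critX c ν = x := by
  have h : H.CritInt c ν := ⟨x, hne, hx, hcrit⟩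
  refine ⟨h, ?_⟩
  obtain ⟨_, hx₀, hcrit₀⟩ := H.critX_spec h
  have hxc : x ∈ H.chord c := by rw [H.chord_eq hne]; exact Ioo_subset_Icc_self hx
  exact H.crit_unique (H.critX_mem h).1 hxc hcrit₀ hcrit

/-- Existence of an interior stationary point by the intermediate value theorem:
`F_d(pt lo) < ν < F_d(pt hi)`. [folklore] -/
theorem critInt_of_between {c ν : ℝ} (hne : (H.chord c).Nonempty)
    (h1 : Fd (H.pt (H.lo c) c) < ν) (h2 : ν < Fd (H.pt (H.hi c) c)) : H.CritInt c ν := by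
  have hlh : H.lo c ≤ H.hi c := H.lo_le_hi hne
  have hcont : ContinuousOn (fun a : ℝ => Fd (H.pt a c)) (Icc (H.lo c) (H.hi c)) := by
    intro y hy
    rw [← H.chord_eq hne] at hy
    exact (H.line2 c y hy).continuousAt.continuousWithinAt
  have := intermediate_value_Ioo hlh hcont
  obtain ⟨x, hx, hxν⟩ := this ⟨h1, h2⟩
  exact ⟨x, hne, hx, hxν⟩

/-- Conversely an interior stationary point forces `F_d(pt lo) < ν < F_d(pt hi)`. [folklore] -/
theorem between_of_critInt {c ν : ℝ} (h : H.CritInt c ν) :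
    Fd (H.pt (H.lo c) c) < ν ∧ ν < Fd (H.pt (H.hi c) c) := by
  obtain ⟨hne, hx, hcrit⟩ := H.critX_spec h
  have hr := H.hr
  have hxc := (H.critX_mem h).1
  have h1 := (H.Fd_incr (H.lo_mem hne) hxc hx.1.le).1
  have h2 := (H.Fd_incr hxc (H.hi_mem hne) hx.2.le).1
  rw [critZ_def] at hcrit
  constructor
  · nlinarith [hx.1]
  · nlinarith [hx.2]

/-- The critical value is a lower bound for `F(pt a c) - νa` on the chord. [folklore] -/
theorem critVal_le {c ν a : ℝ} (ha : a ∈ H.chord c) : H.critVal c ν ≤ F (H.pt a c) - ν * a := by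
  have hcont : ContinuousOn (fun a : ℝ => F (H.pt a c) - ν * a) (H.chord c) := fun y hy =>
    (H.hasDerivAt_Ψ c ν hy).continuousAt.continuousWithinAt
  have hbdd : BddBelow ((fun a : ℝ => F (H.pt a c) - ν * a) '' H.chord c) :=
    ((H.isCompact_chord c).image_of_continuousOn hcont).isBounded.bddBelow
  exact csInf_le hbdd (Set.mem_image_of_mem _ ha)

/-- Any uniform lower bound on the chord is below the critical value. [folklore] -/
theorem le_critVal {c ν m : ℝ} (hne : (H.chord c).Nonempty) (hm : ∀ a ∈ H.chord c, m ≤ F (H.pt a c) - ν * a) :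
    m ≤ H.critVal c ν := by
  refine le_csInf (hne.image _) ?_
  rintro _ ⟨a, ha, rfl⟩
  exact hm a ha

/-- At an interior stationary point the critical value is attained: `q(c, ν) = F(z) - ν x`, and
`F(pt a c) - νa ≥ q(c, ν) + (r/2)(a - x)²` on the chord. [folklore] -/
theorem critVal_eq {c ν : ℝ} (h : H.CritInt c ν) :
    H.critVal c ν = F (H.critZ c ν) - ν * H.critX c ν ∧
      ∀ a ∈ H.chord c, F (H.critZ c ν) - ν * H.critX c ν + r / 2 * (a - H.critX c ν) ^ 2 ≤ F (H.pt a c) - ν * a := by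
  obtain ⟨hne, hx, hcrit⟩ := H.critX_spec h
  have hxI : H.critX c ν ∈ Icc (H.lo c) (H.hi c) := Ioo_subset_Icc_self hx
  have hmin : ∀ a ∈ H.chord c,
      F (H.critZ c ν) - ν * H.critX c ν + r / 2 * (a - H.critX c ν) ^ 2 ≤ F (H.pt a c) - ν * a := by
    intro a ha
    rw [H.chord_eq hne] at ha
    have := crit_min (Ψ := fun a : ℝ => F (H.pt a c) - ν * a) (H.hasDerivAt_Ψ' hne ν) (H.Ψ'_incr hne ν) hxI
      (by rw [critZ_def] at hcrit; simp [hcrit]) ha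
    simpa [critZ_def] using this
  refine ⟨le_antisymm ?_ ?_, hmin⟩
  · have := H.critVal_le (ν := ν) (H.critX_mem h).1
    rwa [critZ_def]
  · refine H.le_critVal hne fun a ha => ?_
    have := hmin a ha
    have hr := H.hr
    nlinarith [sq_nonneg (a - H.critX c ν)]

/-- Without an interior stationary point, or at a point within `δ₀` of `Tᶜ`, the amplitude vanishes.
[folklore] -/
theorem ampl_eq_zero_of_not {c ν : ℝ} (h : ¬ H.CritInt c ν) : H.ampl c ν = 0 := by
  rw [ampl, if_neg h]

/-- At a point within `δ₀` of `Tᶜ` the amplitude vanishes. [folklore] -/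
theorem ampl_eq_zero_of_infDist {c ν : ℝ} (h : infDist (H.critZ c ν) Tᶜ < δ₀) : H.ampl c ν = 0 := by
  unfold ampl
  split_ifs
  · rw [H.hφ0 _ h, zero_div]
  · rfl

/-- The amplitude at an interior stationary point. [folklore] -/
theorem ampl_eq {c ν : ℝ} (h : H.CritInt c ν) :
    H.ampl c ν = φ (H.critZ c ν) / Real.sqrt (2 * π * Fdd (H.critZ c ν)) := by
  rw [ampl, if_pos h]


/-! ### The constants -/

/-- `s_M = Λ₂/r ≥ 0`. [folklore] -/
theorem sM_nonneg : 0 ≤ Λ₂ / r := div_nonneg H.hΛ₂ H.hr.le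

/-- The shift `s* = -σ F_de(z)/F_dd(z)` has `|s*| ≤ Λ₂/r` for `|σ| ≤ 1`, `z ∈ T`. [folklore] -/
theorem abs_shift_le {z : ℂ} (hz : z ∈ T) {σ : ℝ} (hσ : |σ| ≤ 1) : |-(σ * Fde z / Fdd z)| ≤ Λ₂ / r := by
  have hFdd := (H.hFdd z hz).1
  have hr := H.hr
  have hpos : 0 < Fdd z := hr.trans_le hFdd
  rw [abs_neg, abs_div, abs_mul, abs_of_pos hpos]
  calc |σ| * |Fde z| / Fdd z ≤ 1 * Λ₂ / r := by
        refine div_le_div₀ (by have := H.hΛ₂; positivity) ?_ hr hFdd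
        exact mul_le_mul hσ (H.hFde z hz) (abs_nonneg _) zero_le_one
    _ = Λ₂ / r := by ring

/-- "Deep" stationary points: interior and at distance `≥ δ₁ = ‖e‖ + (Λ₂/r + 2)‖d‖ + 1` from `Tᶜ`. [folklore] -/
def Deep (_H : TransverseHyp T d e F Fd Fe Fdd Fde Fee φ r A Λ₂ Λ₃ κ₁ κ₂ L₂ G Lφ δ₀) (c ν : ℝ) : Prop :=
  _H.CritInt c ν ∧ ‖e‖ + (Λ₂ / r + 2) * ‖d‖ + 1 ≤ infDist (_H.critZ c ν) Tᶜ

/-- The shifted points as `z + (s d + σ e)`. [folklore] -/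
theorem pt_shift (c ν s σ : ℝ) : H.pt (H.critX c ν + s) (c + σ) = H.critZ c ν + ((s : ℂ) * d + (σ : ℂ) * e) := by
  rw [H.pt_add, critZ_def]

/-- Near a deep stationary point, the shifted points `pt (x + s) (c + σ)`, `|s| ≤ Λ₂/r + 2`, `|σ| ≤ 1`, lie in `T`.
[folklore] -/
theorem step_mem {c ν : ℝ} (h : H.Deep c ν) {s σ : ℝ} (hs : |s| ≤ Λ₂ / r + 2) (hσ : |σ| ≤ 1) :
    H.pt (H.critX c ν + s) (c + σ) ∈ T := by
  refine mem_of_norm_sub_lt h.2 ?_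
  rw [H.pt_shift, add_sub_cancel_left]
  refine (norm_step_le s σ).trans_lt ?_
  have hd : 0 ≤ ‖d‖ := norm_nonneg _
  have he : 0 ≤ ‖e‖ := norm_nonneg _
  nlinarith [mul_le_mul_of_nonneg_right hs hd, mul_le_mul_of_nonneg_right hσ he]

/-- The chord of the next line contains `[x + s* - 2, x + s* + 2]`. [folklore] -/
theorem next_chord {c ν : ℝ} (h : H.Deep c ν) {σ : ℝ} (hσ : |σ| ≤ 1) {s₀ : ℝ} (hs₀ : |s₀| ≤ Λ₂ / r) :
    (H.chord (c + σ)).Nonempty ∧ H.lo (c + σ) ≤ H.critX c ν + s₀ - 2 ∧ H.critX c ν + s₀ + 2 ≤ H.hi (c + σ) := by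
  refine H.lo_le_of_Icc (fun a ha => ?_) (by linarith)
  have : a = H.critX c ν + (a - H.critX c ν) := by ring
  rw [this]
  refine H.step_mem h ?_ hσ
  rw [abs_le]; constructor <;> linarith [ha.1, ha.2, abs_le.1 hs₀]

/-! ### The critical values along consecutive lines -/

set_option maxHeartbeats 400000 in
/-- **One step across the lines.**  At a deep stationary point `z = z_{c,ν}` with `x = x_ν(c)`, for `σ = ±1`:
`|q(c + σ, ν) - q(c, ν) - σ F_e(z) - ½(F_ee - F_de²/F_dd)(z)| ≤ E_T = Λ₃(s_M + 1)³ + Λ₃²(s_M + 1)⁴/(2r)`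
(`s_M = Λ₂/r`): the upper bound by testing `a₀ = x + s*`, `s* = -σF_de/F_dd`, on the line `c + σ`, the lower bound by
strong convexity of `a ↦ F(pt a (c+σ)) - νa` around `a₀`, where its derivative is `O(Λ₃(s_M+1)²)`.
[cite: Kratzel1988, §2.2] -/
theorem critVal_step {c ν : ℝ} (h : H.Deep c ν) {σ : ℝ} (hσ : σ = 1 ∨ σ = -1) :
    |H.critVal (c + σ) ν - H.critVal c ν - σ * Fe (H.critZ c ν)
        - (Fee (H.critZ c ν) - Fde (H.critZ c ν) ^ 2 / Fdd (H.critZ c ν)) / 2|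
      ≤ Λ₃ * (Λ₂ / r + 1) ^ 3 + Λ₃ ^ 2 * (Λ₂ / r + 1) ^ 4 / (2 * r) := by
  obtain ⟨hCI, hdeep⟩ := h
  obtain ⟨hne, hxI, hcrit⟩ := H.critX_spec hCI
  set x := H.critX c ν with hx
  set z := H.critZ c ν with hz
  have hzT : z ∈ T := (H.critX_mem hCI).2
  have hr := H.hr
  have hΛ₃ := H.hΛ₃
  have hsM := H.sM_nonneg
  have hFdd := (H.hFdd z hzT).1
  have hFpos : 0 < Fdd z := hr.trans_le hFdd
  have hσ1 : |σ| ≤ 1 := by rcases hσ with h | h <;> simp [h]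
  have hσsq : σ ^ 2 = 1 := by rcases hσ with h | h <;> simp [h]
  -- the shift and the test point
  set sS : ℝ := -(σ * Fde z / Fdd z) with hsS
  have hsSle : |sS| ≤ Λ₂ / r := H.abs_shift_le hzT hσ1
  have hsS1 : |sS| + 1 ≤ Λ₂ / r + 1 := by linarith
  set a₀ : ℝ := x + sS with ha₀
  have hmem : H.pt a₀ (c + σ) ∈ T := H.step_mem ⟨hCI, hdeep⟩ (by linarith [abs_nonneg sS]) hσ1
  have hmem' : z + ((sS : ℂ) * d + (σ : ℂ) * e) ∈ T := by rw [← H.pt_shift]; exact hmem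
  have hne₁ : (H.chord (c + σ)).Nonempty := ⟨a₀, hmem⟩
  have ha₀c : a₀ ∈ H.chord (c + σ) := hmem
  -- Taylor expansions at `z`
  have hsS2 : |sS| ≤ Λ₂ / r + 2 := by linarith
  have tF := H.taylorF z hzT sS σ hsS2 hσ1 hmem'
  have tFd := H.taylorFd z hzT sS σ hsS2 hσ1 hmem'
  rw [← H.pt_shift] at tF tFd
  -- the key cancellations
  have hFdz : Fd z = ν := hcrit
  have hcancel1 : sS * Fdd z + σ * Fde z = 0 := by rw [hsS]; field_simp; ring
  have hcancel2 : sS ^ 2 * Fdd z + 2 * sS * σ * Fde z = -(Fde z ^ 2 / Fdd z) := by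
    rw [hsS]; field_simp; rw [hσsq]; ring
  have hq : H.critVal c ν = F z - ν * x := (H.critVal_eq hCI).1
  -- bounds on the Taylor errors
  have hpow3 : Λ₃ * (|sS| + 1) ^ 3 ≤ Λ₃ * (Λ₂ / r + 1) ^ 3 :=
    mul_le_mul_of_nonneg_left (pow_le_pow_left₀ (by positivity) hsS1 3) hΛ₃
  have hpow2 : Λ₃ * (|sS| + 1) ^ 2 ≤ Λ₃ * (Λ₂ / r + 1) ^ 2 :=
    mul_le_mul_of_nonneg_left (pow_le_pow_left₀ (by positivity) hsS1 2) hΛ₃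
  -- the value at the test point
  have hval : |(F (H.pt a₀ (c + σ)) - ν * a₀) - (H.critVal c ν + σ * Fe z + (Fee z - Fde z ^ 2 / Fdd z) / 2)|
      ≤ Λ₃ * (Λ₂ / r + 1) ^ 3 := by
    have : (F (H.pt a₀ (c + σ)) - ν * a₀) - (H.critVal c ν + σ * Fe z + (Fee z - Fde z ^ 2 / Fdd z) / 2)
        = F (H.pt a₀ (c + σ)) - F z - (sS * Fd z + σ * Fe z)
          - (sS ^ 2 * Fdd z + 2 * sS * σ * Fde z + σ ^ 2 * Fee z) / 2 := by
      rw [hq, hFdz, hcancel2, hσsq, ha₀]; ring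
    rw [this]
    exact tF.trans hpow3
  -- the derivative at the test point
  have hder : |Fd (H.pt a₀ (c + σ)) - ν| ≤ Λ₃ * (Λ₂ / r + 1) ^ 2 := by
    have : Fd (H.pt a₀ (c + σ)) - ν = Fd (H.pt a₀ (c + σ)) - Fd z - (sS * Fdd z + σ * Fde z) := by
      rw [hcancel1, hFdz]; ring
    rw [this]
    exact tFd.trans hpow2
  -- ### upper bound: test the point `a₀`
  have hupper : H.critVal (c + σ) ν ≤ F (H.pt a₀ (c + σ)) - ν * a₀ := H.critVal_le ha₀c
  -- ### lower bound: strong convexity around `a₀` on the line `c + σ`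
  have ha₀I : a₀ ∈ Icc (H.lo (c + σ)) (H.hi (c + σ)) := by rw [← H.chord_eq hne₁]; exact ha₀c
  have hlower : (F (H.pt a₀ (c + σ)) - ν * a₀) - (Fd (H.pt a₀ (c + σ)) - ν) ^ 2 / (2 * r)
      ≤ H.critVal (c + σ) ν := by
    refine H.le_critVal hne₁ fun a ha => ?_
    have haI : a ∈ Icc (H.lo (c + σ)) (H.hi (c + σ)) := by rw [← H.chord_eq hne₁]; exact ha
    exact min_lower (Ψ := fun a : ℝ => F (H.pt a (c + σ)) - ν * a) hr (H.hasDerivAt_Ψ' hne₁ ν)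
      (H.Ψ'_incr hne₁ ν) ha₀I haI
  -- the square of the derivative
  have hdersq : (Fd (H.pt a₀ (c + σ)) - ν) ^ 2 / (2 * r) ≤ Λ₃ ^ 2 * (Λ₂ / r + 1) ^ 4 / (2 * r) := by
    refine div_le_div_of_nonneg_right ?_ (by positivity)
    calc (Fd (H.pt a₀ (c + σ)) - ν) ^ 2 = |Fd (H.pt a₀ (c + σ)) - ν| ^ 2 := (sq_abs _).symm
      _ ≤ (Λ₃ * (Λ₂ / r + 1) ^ 2) ^ 2 := pow_le_pow_left₀ (abs_nonneg _) hder 2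
      _ = Λ₃ ^ 2 * (Λ₂ / r + 1) ^ 4 := by ring
  -- ### combine
  have h1 := abs_le.1 hval
  have hE4 : 0 ≤ Λ₃ ^ 2 * (Λ₂ / r + 1) ^ 4 / (2 * r) := by positivity
  have hD0 : 0 ≤ (Fd (H.pt a₀ (c + σ)) - ν) ^ 2 / (2 * r) := by positivity
  rw [abs_le]
  constructor <;> linarith [h1.1, h1.2, hupper, hlower, hdersq]

/-- **Second differences of the critical values**: at a deep stationary point (middle line `c`),
`κ₁/2 ≤ -(q(c+1,ν) - 2q(c,ν) + q(c-1,ν)) ≤ κ₂ + κ₁/2`. [cite: Kratzel1988, §2.2] -/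
theorem second_diff {c ν : ℝ} (h : H.Deep c ν) :
    κ₁ / 2 ≤ -(H.critVal (c + 1) ν - 2 * H.critVal c ν + H.critVal (c + -1) ν) ∧
      -(H.critVal (c + 1) ν - 2 * H.critVal c ν + H.critVal (c + -1) ν) ≤ κ₂ + κ₁ / 2 := by
  have h1 := abs_le.1 (H.critVal_step h (σ := 1) (Or.inl rfl))
  have h2 := abs_le.1 (H.critVal_step h (σ := -1) (Or.inr rfl))
  have hzT : H.critZ c ν ∈ T := (H.critX_mem h.1).2
  have hκ := H.hκ _ hzT
  have hsm := H.hsmall2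
  have hFpos : 0 < Fdd (H.critZ c ν) := H.hr.trans_le (H.hFdd _ hzT).1
  -- `-(F_ee - F_de²/F_dd) = (F_de² - F_dd F_ee)/F_dd`
  have hκ₀ : -(Fee (H.critZ c ν) - Fde (H.critZ c ν) ^ 2 / Fdd (H.critZ c ν))
      = (Fde (H.critZ c ν) ^ 2 - Fdd (H.critZ c ν) * Fee (H.critZ c ν)) / Fdd (H.critZ c ν) := by
    field_simp; ring
  rw [← hκ₀] at hκ
  constructor <;> nlinarith [h1.1, h1.2, h2.1, h2.2, hκ.1, hκ.2, hsm]

/-! ### Root localisation and the amplitudes -/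

/-- **Root localisation**: if the lines `c` (deep) and `c + σ` both carry interior stationary points, then
`|x_ν(c + σ) - (x_ν(c) + s*)| ≤ 1/2`, `s* = -σF_de/F_dd`. [folklore] -/
theorem critX_step {c ν : ℝ} (h : H.Deep c ν) {σ : ℝ} (hσ : σ = 1 ∨ σ = -1) (h' : H.CritInt (c + σ) ν) :
    |H.critX (c + σ) ν - (H.critX c ν + -(σ * Fde (H.critZ c ν) / Fdd (H.critZ c ν)))| ≤ 1 / 2 := by
  obtain ⟨hCI, hdeep⟩ := h
  obtain ⟨hne, hxI, hcrit⟩ := H.critX_spec hCI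
  obtain ⟨hne₁, hx'I, hcrit'⟩ := H.critX_spec h'
  set z := H.critZ c ν with hz
  have hzT : z ∈ T := (H.critX_mem hCI).2
  have hr := H.hr
  have hσ1 : |σ| ≤ 1 := by rcases hσ with h | h <;> simp [h]
  set sS : ℝ := -(σ * Fde z / Fdd z) with hsS
  have hsSle : |sS| ≤ Λ₂ / r := H.abs_shift_le hzT hσ1
  set a₀ : ℝ := H.critX c ν + sS with ha₀
  have hmem : H.pt a₀ (c + σ) ∈ T := H.step_mem ⟨hCI, hdeep⟩ (by linarith [abs_nonneg sS, H.sM_nonneg]) hσ1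
  have hmem' : z + ((sS : ℂ) * d + (σ : ℂ) * e) ∈ T := by rw [← H.pt_shift]; exact hmem
  have tFd := H.taylorFd z hzT sS σ (by linarith [abs_nonneg sS]) hσ1 hmem'
  rw [← H.pt_shift] at tFd
  have hFpos : 0 < Fdd z := hr.trans_le (H.hFdd z hzT).1
  have hcancel1 : sS * Fdd z + σ * Fde z = 0 := by rw [hsS]; field_simp; ring
  have hder : |Fd (H.pt a₀ (c + σ)) - ν| ≤ Λ₃ * (Λ₂ / r + 1) ^ 2 := by
    have : Fd (H.pt a₀ (c + σ)) - ν = Fd (H.pt a₀ (c + σ)) - Fd z - (sS * Fdd z + σ * Fde z) := by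
      rw [hcancel1, hz, hcrit]; ring
    rw [this]
    refine tFd.trans (mul_le_mul_of_nonneg_left (pow_le_pow_left₀ (by positivity) (by linarith) 2) H.hΛ₃)
  -- both points lie in the chord of the line `c + σ`
  have ha₀I : a₀ ∈ Icc (H.lo (c + σ)) (H.hi (c + σ)) := by rw [← H.chord_eq hne₁]; exact hmem
  have hx'I' : H.critX (c + σ) ν ∈ Icc (H.lo (c + σ)) (H.hi (c + σ)) := Ioo_subset_Icc_self hx'I
  have hsep := deriv_sep (H.Ψ'_incr hne₁ ν) hx'I' ha₀I
  rw [critZ_def] at hcrit'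
  rw [hcrit', sub_self, zero_sub, abs_neg] at hsep
  have hsm := H.hsmall1
  have : r * |H.critX (c + σ) ν - a₀| ≤ r * (1 / 2) := (hsep.trans (hder.trans hsm)).trans_eq (by ring)
  exact le_of_mul_le_mul_left this hr

/-- Consequently the two stationary points are within `ℓ₀ = ‖e‖ + (Λ₂/r + 1)‖d‖` of each other. [folklore] -/
theorem norm_critZ_step {c ν : ℝ} (h : H.Deep c ν) {σ : ℝ} (hσ : σ = 1 ∨ σ = -1) (h' : H.CritInt (c + σ) ν) :
    ‖H.critZ (c + σ) ν - H.critZ c ν‖ ≤ ‖e‖ + (Λ₂ / r + 1) * ‖d‖ := by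
  have hloc := H.critX_step h hσ h'
  have hzT : H.critZ c ν ∈ T := (H.critX_mem h.1).2
  have hσ1 : |σ| ≤ 1 := by rcases hσ with h | h <;> simp [h]
  have hsSle := H.abs_shift_le hzT hσ1
  set t : ℝ := H.critX (c + σ) ν - H.critX c ν with ht
  have ht' : H.critX (c + σ) ν = H.critX c ν + t := by rw [ht]; ring
  have hpt : H.critZ (c + σ) ν = H.critZ c ν + ((t : ℂ) * d + (σ : ℂ) * e) := by
    rw [critZ_def, ht', H.pt_shift]
  rw [hpt, add_sub_cancel_left]
  refine (norm_step_le t σ).trans ?_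
  have htle : |t| ≤ Λ₂ / r + 1 := by
    have : t = (H.critX (c + σ) ν - (H.critX c ν + -(σ * Fde (H.critZ c ν) / Fdd (H.critZ c ν))))
      + -(σ * Fde (H.critZ c ν) / Fdd (H.critZ c ν)) := by rw [ht]; ring
    rw [this]
    refine (abs_add_le _ _).trans ?_
    linarith
  have hd : 0 ≤ ‖d‖ := norm_nonneg _
  nlinarith [mul_le_mul_of_nonneg_right htle hd, mul_le_mul_of_nonneg_right hσ1 (norm_nonneg e)]

/-- **A deep stationary point propagates**: the neighbouring lines `c ± 1` carry interior stationary points.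
[folklore] -/
theorem critInt_step {c ν : ℝ} (h : H.Deep c ν) {σ : ℝ} (hσ : σ = 1 ∨ σ = -1) : H.CritInt (c + σ) ν := by
  obtain ⟨hCI, hdeep⟩ := h
  obtain ⟨hne, hxI, hcrit⟩ := H.critX_spec hCI
  set z := H.critZ c ν with hz
  have hzT : z ∈ T := (H.critX_mem hCI).2
  have hr := H.hr
  have hσ1 : |σ| ≤ 1 := by rcases hσ with h | h <;> simp [h]
  set sS : ℝ := -(σ * Fde z / Fdd z) with hsS
  have hsSle : |sS| ≤ Λ₂ / r := H.abs_shift_le hzT hσ1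
  set a₀ : ℝ := H.critX c ν + sS with ha₀
  obtain ⟨hne₁, hlo, hhi⟩ := H.next_chord ⟨hCI, hdeep⟩ hσ1 hsSle
  have hmem : H.pt a₀ (c + σ) ∈ T := H.step_mem ⟨hCI, hdeep⟩ (by linarith [abs_nonneg sS, H.sM_nonneg]) hσ1
  have hmem' : z + ((sS : ℂ) * d + (σ : ℂ) * e) ∈ T := by rw [← H.pt_shift]; exact hmem
  have tFd := H.taylorFd z hzT sS σ (by linarith [abs_nonneg sS]) hσ1 hmem'
  rw [← H.pt_shift] at tFd
  have hFpos : 0 < Fdd z := hr.trans_le (H.hFdd z hzT).1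
  have hcancel1 : sS * Fdd z + σ * Fde z = 0 := by rw [hsS]; field_simp; ring
  have hder : |Fd (H.pt a₀ (c + σ)) - ν| ≤ r / 2 := by
    have : Fd (H.pt a₀ (c + σ)) - ν = Fd (H.pt a₀ (c + σ)) - Fd z - (sS * Fdd z + σ * Fde z) := by
      rw [hcancel1, hz, hcrit]; ring
    rw [this]
    refine tFd.trans ((mul_le_mul_of_nonneg_left (pow_le_pow_left₀ (by positivity) (by linarith) 2) H.hΛ₃).trans
      H.hsmall1)
  have hder' := abs_le.1 hder
  -- the derivative is `< ν` at `lo` and `> ν` at `hi`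
  have hchord := H.chord_eq hne₁
  have hloI : H.lo (c + σ) ∈ H.chord (c + σ) := H.lo_mem hne₁
  have hhiI : H.hi (c + σ) ∈ H.chord (c + σ) := H.hi_mem hne₁
  have ha₀c : a₀ ∈ H.chord (c + σ) := hmem
  have h1 := (H.Fd_incr hloI ha₀c (by linarith)).1
  have h2 := (H.Fd_incr ha₀c hhiI (by linarith)).1
  refine H.critInt_of_between hne₁ ?_ ?_
  · nlinarith
  · nlinarith

/-- **The amplitude vanishes at the first line of a run**: if `c` is deep and `c - 1` is not, `A(c, ν) = 0`.
[folklore] -/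
theorem ampl_start {c ν : ℝ} (h : H.Deep c ν) (h' : ¬ H.Deep (c + -1) ν) : H.ampl c ν = 0 := by
  have hCI' : H.CritInt (c + -1) ν := H.critInt_step h (Or.inr rfl)
  have hnotdeep : infDist (H.critZ (c + -1) ν) Tᶜ < ‖e‖ + (Λ₂ / r + 2) * ‖d‖ + 1 := by
    by_contra hcon
    exact h' ⟨hCI', not_lt.1 hcon⟩
  have hclose := H.norm_critZ_step h (Or.inr rfl) hCI'
  refine H.ampl_eq_zero_of_infDist ?_
  have hlip := infDist_le_infDist_add_dist (x := H.critZ c ν) (y := H.critZ (c + -1) ν) (s := Tᶜ)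
  rw [dist_comm, dist_eq_norm] at hlip
  have hδ₀ := H.hδ₀
  have hd : 0 ≤ ‖d‖ := norm_nonneg _
  nlinarith

omit H in
/-- `|u^{-1/2} - v^{-1/2}| ≤ |u - v|/(2 m^{3/2})` for `u, v ≥ m > 0`. [folklore] -/
theorem abs_inv_sqrt_sub_le {m u v : ℝ} (hm : 0 < m) (hu : m ≤ u) (hv : m ≤ v) :
    |(Real.sqrt u)⁻¹ - (Real.sqrt v)⁻¹| ≤ |u - v| / (2 * (m * Real.sqrt m)) := by
  have hu0 : 0 < u := hm.trans_le hu
  have hv0 : 0 < v := hm.trans_le hv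
  have hsu : 0 < Real.sqrt u := Real.sqrt_pos.2 hu0
  have hsv : 0 < Real.sqrt v := Real.sqrt_pos.2 hv0
  have hsm : 0 < Real.sqrt m := Real.sqrt_pos.2 hm
  have hmu : Real.sqrt m ≤ Real.sqrt u := Real.sqrt_le_sqrt hu
  have hmv : Real.sqrt m ≤ Real.sqrt v := Real.sqrt_le_sqrt hv
  have heq : (Real.sqrt u)⁻¹ - (Real.sqrt v)⁻¹ = (v - u) / (Real.sqrt u * Real.sqrt v * (Real.sqrt u + Real.sqrt v)) := by
    have h1 : Real.sqrt v - Real.sqrt u = (v - u) / (Real.sqrt u + Real.sqrt v) := by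
      rw [eq_div_iff (by positivity)]
      nlinarith [Real.mul_self_sqrt hu0.le, Real.mul_self_sqrt hv0.le]
    field_simp
    nlinarith [Real.mul_self_sqrt hu0.le, Real.mul_self_sqrt hv0.le]
  have hden : 0 < Real.sqrt u * Real.sqrt v * (Real.sqrt u + Real.sqrt v) := by positivity
  have hden2 : 0 < 2 * (m * Real.sqrt m) := by positivity
  rw [heq, abs_div, abs_of_pos hden, abs_sub_comm]
  refine div_le_div_of_nonneg_left (abs_nonneg (u - v)) hden2 ?_
  have h1 : m ≤ Real.sqrt u * Real.sqrt v := by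
    have := mul_le_mul hmu hmv hsm.le hsu.le
    rwa [Real.mul_self_sqrt hm.le] at this
  have h2 : 2 * Real.sqrt m ≤ Real.sqrt u + Real.sqrt v := by linarith
  calc 2 * (m * Real.sqrt m) = m * (2 * Real.sqrt m) := by ring
    _ ≤ (Real.sqrt u * Real.sqrt v) * (Real.sqrt u + Real.sqrt v) :=
        mul_le_mul h1 h2 (by positivity) (by positivity)

/-- **Consecutive amplitudes**: for deep stationary points on the lines `c` and `c + 1`,
`|A(c+1, ν) - A(c, ν)| ≤ δ_A = ℓ₀ (Lφ (2πr)^{-1/2} + π G L₂ (2πr)^{-3/2})`, `ℓ₀ = ‖e‖ + (Λ₂/r + 1)‖d‖`.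
[folklore] -/
theorem ampl_diff {c ν : ℝ} (h : H.Deep c ν) (h' : H.Deep (c + 1) ν) :
    |H.ampl (c + 1) ν - H.ampl c ν|
      ≤ (‖e‖ + (Λ₂ / r + 1) * ‖d‖) *
          (Lφ / Real.sqrt (2 * π * r) + π * G * L₂ / ((2 * π * r) * Real.sqrt (2 * π * r))) := by
  set z := H.critZ c ν with hz
  set z' := H.critZ (c + 1) ν with hz'
  have hzT : z ∈ T := (H.critX_mem h.1).2
  have hz'T : z' ∈ T := (H.critX_mem h'.1).2
  have hr := H.hr
  have hπ := Real.pi_pos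
  have hm : 0 < 2 * π * r := by positivity
  have hu : 2 * π * r ≤ 2 * π * Fdd z := by nlinarith [(H.hFdd z hzT).1]
  have hv : 2 * π * r ≤ 2 * π * Fdd z' := by nlinarith [(H.hFdd z' hz'T).1]
  have hclose : ‖z' - z‖ ≤ ‖e‖ + (Λ₂ / r + 1) * ‖d‖ := H.norm_critZ_step h (Or.inl rfl) h'.1
  rw [H.ampl_eq h.1, H.ampl_eq h'.1]
  set ℓ := ‖e‖ + (Λ₂ / r + 1) * ‖d‖ with hℓ
  have hℓ0 : 0 ≤ ℓ := by have := H.sM_nonneg; positivity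
  have hsr : 0 < Real.sqrt (2 * π * r) := Real.sqrt_pos.2 hm
  have hsu : Real.sqrt (2 * π * r) ≤ Real.sqrt (2 * π * Fdd z') := Real.sqrt_le_sqrt hv
  -- split `A' - A = (φ' - φ)/√u' + φ (1/√u' - 1/√u)`
  have hsplit : φ z' / Real.sqrt (2 * π * Fdd z') - φ z / Real.sqrt (2 * π * Fdd z)
      = (φ z' - φ z) * (Real.sqrt (2 * π * Fdd z'))⁻¹
        + φ z * ((Real.sqrt (2 * π * Fdd z'))⁻¹ - (Real.sqrt (2 * π * Fdd z))⁻¹) := by ring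
  rw [hsplit]
  refine (abs_add_le _ _).trans ?_
  have t1 : |(φ z' - φ z) * (Real.sqrt (2 * π * Fdd z'))⁻¹| ≤ Lφ * ℓ / Real.sqrt (2 * π * r) := by
    rw [abs_mul, abs_inv, abs_of_pos (hsr.trans_le hsu), ← div_eq_mul_inv]
    refine div_le_div₀ (by have := H.hLφ; positivity) ?_ hsr hsu
    exact (H.lipφ z' hz'T z hzT).trans (mul_le_mul_of_nonneg_left hclose H.hLφ)
  have t2 : |φ z * ((Real.sqrt (2 * π * Fdd z'))⁻¹ - (Real.sqrt (2 * π * Fdd z))⁻¹)|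
      ≤ G * (2 * π * L₂ * ℓ / (2 * ((2 * π * r) * Real.sqrt (2 * π * r)))) := by
    rw [abs_mul]
    refine mul_le_mul (H.hφG z hzT) ?_ (abs_nonneg _) H.hG
    have hnum : |2 * π * Fdd z' - 2 * π * Fdd z| ≤ 2 * π * L₂ * ℓ := by
      have hlip : |Fdd z' - Fdd z| ≤ L₂ * ℓ :=
        (H.lipFdd z' hz'T z hzT).trans (mul_le_mul_of_nonneg_left hclose H.hL₂)
      have h2π : (0 : ℝ) < 2 * π := by positivity
      calc |2 * π * Fdd z' - 2 * π * Fdd z| = 2 * π * |Fdd z' - Fdd z| := by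
            rw [← mul_sub, abs_mul, abs_of_pos h2π]
        _ ≤ 2 * π * (L₂ * ℓ) := mul_le_mul_of_nonneg_left hlip h2π.le
        _ = 2 * π * L₂ * ℓ := by ring
    have hden0 : 0 ≤ 2 * ((2 * π * r) * Real.sqrt (2 * π * r)) := by positivity
    exact (abs_inv_sqrt_sub_le hm hv hu).trans (div_le_div_of_nonneg_right hnum hden0)
  refine (add_le_add t1 t2).trans (le_of_eq ?_)
  rw [hℓ]
  ring


/-! ### The transverse bound -/

/-- Without a DEEP stationary point the amplitude vanishes. [folklore] -/
theorem ampl_eq_zero_of_not_deep {c ν : ℝ} (h : ¬ H.Deep c ν) : H.ampl c ν = 0 := by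
  by_cases hCI : H.CritInt c ν
  · have hlt : infDist (H.critZ c ν) Tᶜ < ‖e‖ + (Λ₂ / r + 2) * ‖d‖ + 1 := by
      by_contra hcon; exact h ⟨hCI, not_lt.1 hcon⟩
    refine H.ampl_eq_zero_of_infDist (hlt.trans_le ?_)
    have hδ₀ := H.hδ₀
    have : 0 ≤ ‖e‖ + (Λ₂ / r + 2) * ‖d‖ + 1 := by have := H.sM_nonneg; positivity
    linarith
  · exact H.ampl_eq_zero_of_not hCI

/-- A deep stationary point lies on a line whose chord is nonempty. [folklore] -/
theorem chord_nonempty_of_deep {c ν : ℝ} (h : H.Deep c ν) : (H.chord c).Nonempty := (H.critX_spec h.1).1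

omit H in
/-- `‖∑ A(n) e(q(n))‖ = ‖∑ A(n) e(-q(n))‖` for real amplitudes (complex conjugation). [folklore] -/
theorem norm_sum_real_mul_e_neg (S : Finset ℤ) (A : ℤ → ℝ) (q : ℤ → ℝ) :
    ‖∑ n ∈ S, (A n : ℂ) * VdC.e (q n)‖ = ‖∑ n ∈ S, (A n : ℂ) * VdC.e (-q n)‖ := by
  rw [← RCLike.norm_conj (∑ n ∈ S, (A n : ℂ) * VdC.e (q n)), map_sum]
  congr 1
  refine Finset.sum_congr rfl fun n _ => ?_
  rw [map_mul, Complex.conj_ofReal, e_neg]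

/-- **The transverse bound.**  Let all nonempty chords have indices in `[b₁, b₂]` (`b₁ ≤ b₂`).  Then for every finite
set `N` of frequencies,
`‖∑_{ν ∈ N} ∑_{b₁ ≤ b ≤ b₂} A(b, ν) e(q(b, ν))‖ ≤ #N · δ_A L (12 (h L (κ₁/2)^{1/2} + (κ₁/2)^{-1/2}) + 1)`,
`L = b₂ - b₁ + 1`, `h = (κ₂ + κ₁/2)/(κ₁/2)`, `δ_A = (‖e‖ + (Λ₂/r + 1)‖d‖)(Lφ(2πr)^{-1/2} + πGL₂(2πr)^{-3/2})`:
for each `ν`, Abel summation and the discrete second-difference test on the runs of deep lines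
(`VdC.norm_sum_gapped_le'`), with `ampl_start`, `ampl_diff`, `second_diff`, `ampl_eq_zero_of_not_deep`.
[cite: Kratzel1988, §2.2] [cite: GrahamKolesnik1991, Lemma 6.10] -/
theorem norm_transverse_sum_le {b₁ b₂ : ℤ} (hb : b₁ ≤ b₂)
    (hrange : ∀ b : ℤ, (H.chord b).Nonempty → b₁ ≤ b ∧ b ≤ b₂) (N : Finset ℤ) :
    ‖∑ ν ∈ N, ∑ b ∈ Finset.Icc b₁ b₂, (H.ampl b ν : ℂ) * VdC.e (H.critVal b ν)‖
      ≤ N.card * ((‖e‖ + (Λ₂ / r + 1) * ‖d‖) *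
            (Lφ / Real.sqrt (2 * π * r) + π * G * L₂ / ((2 * π * r) * Real.sqrt (2 * π * r)))
          * ((b₂ : ℝ) - b₁ + 1) *
          (12 * ((κ₂ + κ₁ / 2) / (κ₁ / 2) * ((b₂ : ℝ) - b₁ + 1) * Real.sqrt (κ₁ / 2) + 1 / Real.sqrt (κ₁ / 2)) + 1)) := by
  set δA : ℝ := (‖e‖ + (Λ₂ / r + 1) * ‖d‖) *
    (Lφ / Real.sqrt (2 * π * r) + π * G * L₂ / ((2 * π * r) * Real.sqrt (2 * π * r))) with hδA
  set μ : ℝ := κ₁ / 2 with hμ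
  set hh : ℝ := (κ₂ + κ₁ / 2) / (κ₁ / 2) with hhh
  have hκ₁ := H.hκ₁
  have hμ0 : 0 < μ := by rw [hμ]; linarith
  have hhh1 : 1 ≤ hh := by
    rw [hhh, le_div_iff₀ hμ0]; linarith [H.hκ₁₂]
  have hhμ : hh * μ = κ₂ + κ₁ / 2 := by rw [hhh, hμ]; field_simp
  have hδA0 : 0 ≤ δA := by
    have := H.sM_nonneg; have := H.hLφ; have := H.hG; have := H.hL₂; have := H.hr
    positivity
  -- the bound for one frequency
  have hone : ∀ ν : ℤ, ‖∑ b ∈ Finset.Icc b₁ b₂, (H.ampl b ν : ℂ) * VdC.e (H.critVal b ν)‖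
      ≤ δA * ((b₂ : ℝ) - b₁ + 1) * (12 * (hh * ((b₂ : ℝ) - b₁ + 1) * Real.sqrt μ + 1 / Real.sqrt μ) + 1) := by
    intro ν
    rw [norm_sum_real_mul_e_neg]
    have hIcc : Finset.Icc b₁ b₂ = Finset.Ioc (b₁ - 1) b₂ := by
      ext n; simp only [Finset.mem_Icc, Finset.mem_Ioc]; omega
    rw [hIcc]
    set D : Finset ℤ := (Finset.Ioc (b₁ - 1) b₂).filter (fun n : ℤ => H.Deep n ν) with hD
    have hmemD : ∀ n : ℤ, n ∈ D ↔ n ∈ Finset.Ioc (b₁ - 1) b₂ ∧ H.Deep n ν := fun n => by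
      rw [hD, Finset.mem_filter]
    have hdeepIoc : ∀ n : ℤ, H.Deep n ν → n ∈ Finset.Ioc (b₁ - 1) b₂ := by
      intro n hn
      have := hrange n (H.chord_nonempty_of_deep hn)
      rw [Finset.mem_Ioc]; omega
    have key := norm_sum_gapped_le' (A := fun n : ℤ => (H.ampl n ν : ℂ)) (q := fun n : ℤ => -H.critVal n ν)
      (D := D) (a := b₁ - 1) (b := b₂) (δ := δA) (μ := μ) (h := hh) hμ0 hhh1 hδA0 (by omega)
      (fun n hn => ((hmemD n).1 hn).1) ?_ ?_ ?_ ?_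
    · have e1 : ((b₂ : ℤ) : ℝ) - ((b₁ - 1 : ℤ) : ℝ) = (b₂ : ℝ) - b₁ + 1 := by push_cast; ring
      rw [e1] at key
      exact key
    · -- `A` vanishes off `D`
      intro n hn hnD
      have : ¬ H.Deep n ν := fun h => hnD ((hmemD n).2 ⟨hn, h⟩)
      simp only [H.ampl_eq_zero_of_not_deep this, Complex.ofReal_zero]
    · -- `A` vanishes at the first line of a run
      intro n hn hprev
      have hdn : H.Deep n ν := ((hmemD n).1 hn).2
      have hprev' : ¬ H.Deep ((n : ℝ) + -1) ν := by
        intro h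
        have e1 : (n : ℝ) + -1 = ((n - 1 : ℤ) : ℝ) := by push_cast; ring
        rw [e1] at h
        exact hprev ((hmemD (n - 1)).2 ⟨hdeepIoc _ h, h⟩)
      simp only [H.ampl_start hdn hprev', Complex.ofReal_zero]
    · -- consecutive amplitudes
      intro n hn hn1
      have hdn : H.Deep n ν := ((hmemD n).1 hn).2
      have hdn1 : H.Deep ((n : ℝ) + 1) ν := by
        have := ((hmemD (n + 1)).1 hn1).2
        have e1 : (((n + 1 : ℤ)) : ℝ) = (n : ℝ) + 1 := by push_cast; ring
        rwa [e1] at this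
      have := H.ampl_diff hdn hdn1
      have e1 : (n : ℝ) + 1 = (((n + 1 : ℤ)) : ℝ) := by push_cast; ring
      rw [e1] at this
      rw [← Complex.ofReal_sub, Complex.norm_real, Real.norm_eq_abs]
      exact this
    · -- second differences at the middle line `n + 1`
      intro n hn hn1 hn2
      have hmid : H.Deep ((n : ℝ) + 1) ν := by
        have := ((hmemD (n + 1)).1 hn1).2
        have e1 : (((n + 1 : ℤ)) : ℝ) = (n : ℝ) + 1 := by push_cast; ring
        rwa [e1] at this
      have h2 := H.second_diff hmid
      have e1 : (n : ℝ) + 1 + 1 = (((n + 2 : ℤ)) : ℝ) := by push_cast; ring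
      have e2 : (n : ℝ) + 1 + -1 = ((n : ℤ) : ℝ) := by ring
      have e3 : (n : ℝ) + 1 = (((n + 1 : ℤ)) : ℝ) := by push_cast; ring
      rw [e1, e2, e3] at h2
      rw [hhμ]
      constructor <;> linarith [h2.1, h2.2]
  -- sum over the frequencies
  calc ‖∑ ν ∈ N, ∑ b ∈ Finset.Icc b₁ b₂, (H.ampl b ν : ℂ) * VdC.e (H.critVal b ν)‖
      ≤ ∑ ν ∈ N, ‖∑ b ∈ Finset.Icc b₁ b₂, (H.ampl b ν : ℂ) * VdC.e (H.critVal b ν)‖ := norm_sum_le _ _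
    _ ≤ ∑ ν ∈ N, δA * ((b₂ : ℝ) - b₁ + 1) * (12 * (hh * ((b₂ : ℝ) - b₁ + 1) * Real.sqrt μ + 1 / Real.sqrt μ) + 1) :=
        Finset.sum_le_sum fun ν _ => hone ν
    _ = _ := by rw [Finset.sum_const, nsmul_eq_mul]

/-! ### The interface with the `B`-process: stationary data and the main terms of one line -/

/-- For an integer line `b` with a nonempty, non-degenerate chord, every frequency
`⌊F_d(pt lo)⌋ < ν < ⌈F_d(pt hi)⌉` has an interior stationary point, namely `critX b ν`. [folklore] -/
theorem critX_data {c : ℝ} (hne : (H.chord c).Nonempty) {ν : ℤ}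
    (h1 : Fd (H.pt (H.lo c) c) < ν) (h2 : (ν : ℝ) < Fd (H.pt (H.hi c) c)) :
    H.critX c ν ∈ Ioo (H.lo c) (H.hi c) ∧ Fd (H.pt (H.critX c ν) c) = ν := by
  have h := H.critInt_of_between hne h1 h2
  obtain ⟨_, hx, hcrit⟩ := H.critX_spec h
  exact ⟨hx, hcrit⟩

/-- The main term of the `B`-process on the line `c` in terms of `ampl` and `critVal`: for
`⌊F_d(pt lo)⌋ < ν < ⌈F_d(pt hi)⌉`,
`φ(z_ν) e(F(z_ν) - ν x_ν) (2π F_dd(z_ν))^{-1/2} = A(c, ν) e(q(c, ν))`. [folklore] -/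
theorem mainTerm_eq {c : ℝ} (hne : (H.chord c).Nonempty) {ν : ℤ}
    (h1 : Fd (H.pt (H.lo c) c) < ν) (h2 : (ν : ℝ) < Fd (H.pt (H.hi c) c)) :
    (φ (H.pt (H.critX c ν) c) : ℂ) * VdC.e (F (H.pt (H.critX c ν) c) - ν * H.critX c ν)
        * ((Real.sqrt (2 * π * Fdd (H.pt (H.critX c ν) c)))⁻¹ : ℝ)
      = (H.ampl c ν : ℂ) * VdC.e (H.critVal c ν) := by
  have h := H.critInt_of_between hne h1 h2
  rw [H.ampl_eq h, (H.critVal_eq h).1, critZ_def]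
  push_cast
  ring

/-- Conversely the amplitude vanishes for the other frequencies. [folklore] -/
theorem ampl_eq_zero_of_not_between {c : ℝ} {ν : ℝ}
    (h : ¬ (Fd (H.pt (H.lo c) c) < ν ∧ ν < Fd (H.pt (H.hi c) c))) : H.ampl c ν = 0 := by
  refine H.ampl_eq_zero_of_not fun hCI => h ?_
  exact H.between_of_critInt hCI


end TransverseHyp

end VdC
end Literature.NumberTheory.LFunctions

end
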